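import Literature.AlgebraicGeometry.HodgeTheory.OrdinaryDoublePointMorseChart
import Literature.AlgebraicGeometry.HodgeTheory.NodalPencilJointSubmersion
import Mathlib.Topology.Algebra.ConstMulAction
import Mathlib.FieldTheory.IsAlgClosed.Basic
import HarnessLib

/-!
# The Morse chart of the pencil coordinate of a monomial pencil at an ordinary double point

Family `hodge`, layer `Literature/AlgebraicGeometry/HodgeTheory`. Written by the prover seat `hodge-nonav-prover-Bx` (g15, cell
`hodge-nonav`) as a brick of the ODP-ISOTOPY port (memo `PROGRAMME-ODP-ISOTOPY-Bx-g13` §2; Picard–Lefschetz binder hPL₁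
`picardLefschetz_oneNode` of crux K1-B, stmt-HodgeConjecture-19716): the analogue of prover-Ax's
`Geometry/ComplexAnalytic/CyclicNodePencilMorseChart` (the explicit chart of `y₂^p − (y₀y₁ + y₀^p + y₁^p)`) for an ARBITRARY
degree-`d` form `F` in `n + 2` variables at an ordinary double point `[p]` with `p i ≠ 0`, read in the chart `xᵢ ≠ 0` of the regular
locus of the universal family. The solved coefficient of `xᵢ^d` along the pencil `F + c·xᵢ^d` at affine coordinates `y` is
`coeff_{xᵢ^d} F − F(ins_i 1 y)` (`NodalPencilJointSubmersion.regChartCoeffVec_pencil_regPowIndex_of_isHomogeneous`), so the pencil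
coordinate is `φ(y) = −F(ins_i 1 y) = −pᵢ^{−d} F(p + ins_i 0 (pᵢ(y − y₀)))` (`y₀ = (p_{i.succAbove j}/pᵢ)_j` the affine coordinates of
the node, homogeneity); composing the holomorphic Morse chart `Θ₀` of `w ↦ F(p + ins_i 0 w)` at `w = 0`
(`OrdinaryDoublePointMorseChart`) with the affine map `y ↦ pᵢ(y − y₀)` and the scaling by a square root `μ` of `−pᵢ^{−d}` gives a chart
`Θ` with `Σⱼ (Θ y)ⱼ² = φ(y)`:

* `exists_pencil_morseChart` — `∃ Θ`, `y₀ ∈ Θ.source`, `Θ y₀ = 0`, `Θ`, `Θ.symm` real `C^∞`, and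
  `∀ y ∈ Θ.source, Σⱼ (Θ y)ⱼ² = −F(ins_i 1 y)`;
* `exists_pencil_morseChart_coeff` — the same with the conclusion in the form consumed by the port:
  `regChartCoeffVec n d i (b'₀, y) (xᵢ^d) = (b₀)_{xᵢ^d} + Σⱼ (Θ y)ⱼ²` for `b₀ = coeffs F`.

Everything is proved; no definitions, no named facts. Honest scope: a coordinate change; nothing here says HC or any rung is proved.

## References

* [VoisinHodgeII2003] C. Voisin, Hodge Theory and Complex Algebraic Geometry II (2003), §2.1.1 (Morse lemma), §2.3.1–§2.3.2.
* [Milnor1963] J. Milnor, Morse theory, Lemma 2.2.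
-/

noncomputable section

open MvPolynomial Set Function Filter
open scoped Topology ContDiff
open Literature.AlgebraicGeometry.Motives Literature.AlgebraicGeometry.Motives.UniversalHypersurface
open Literature.AlgebraicGeometry.HodgeTheory.UniversalHypersurface Literature.Geometry.ComplexAnalytic
open Literature.NumberTheory.Transcendental

namespace Literature.AlgebraicGeometry.HodgeTheory

namespace NodalPencil

variable {n d : ℕ}

/-- Affine coordinates: `ins_i 1 y = pᵢ⁻¹ • (p + ins_i 0 (pᵢ • (y − y₀)))` for `y₀ = (p_{i.succAbove j} / pᵢ)_j`, `pᵢ ≠ 0`.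
[cite: VoisinHodgeII2003, §2.3.1] -/
theorem insertNth_one_eq_smul (i : Fin (n + 2)) {p : Fin (n + 2) → ℂ} (hpi : p i ≠ 0) (y : Fin (n + 1) → ℂ) :
    (Fin.insertNth i (1 : ℂ) y : Fin (n + 2) → ℂ) =
      (p i)⁻¹ • (p + Fin.insertNth i (0 : ℂ) ((p i) • (y - fun j => p (i.succAbove j) / p i))) := by
  funext k
  refine Fin.succAboveCases i ?_ (fun j => ?_) k
  · simp [Fin.insertNth_apply_same, hpi]
  · simp only [Fin.insertNth_apply_succAbove, Pi.smul_apply, Pi.add_apply, Pi.sub_apply, smul_eq_mul]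
    field_simp
    ring

/-- **The Morse chart of the pencil coordinate at an ordinary double point.** For a form `F` of degree `d ≥ 1` with an ordinary
double point `p`, `p i ≠ 0`, there is a `C^∞` open partial homeomorphism `Θ` of `ℂⁿ⁺¹` with `C^∞` inverse, defined at the affine
coordinates `y₀ = (p_{i.succAbove j}/pᵢ)_j` of the node with `Θ y₀ = 0`, such that `Σⱼ (Θ y)ⱼ² = −F(ins_i 1 y)` on `Θ.source`.
[cite: VoisinHodgeII2003, §2.1.1 and §2.3.1] [cite: Milnor1963, Lemma 2.2] -/
theorem exists_pencil_morseChart {F : MvPolynomial (Fin (n + 2)) ℂ} (hF : F.IsHomogeneous d) (hd : 1 ≤ d)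
    {p : Fin (n + 2) → ℂ} (hp : IsOrdinaryDoublePointOf F p) {i : Fin (n + 2)} (hpi : p i ≠ 0) :
    ∃ Θ : OpenPartialHomeomorph (Fin (n + 1) → ℂ) (Fin (n + 1) → ℂ),
      (fun j => p (i.succAbove j) / p i) ∈ Θ.source ∧ Θ (fun j => p (i.succAbove j) / p i) = 0 ∧
      ContDiffOn ℝ ∞ Θ Θ.source ∧ ContDiffOn ℝ ∞ Θ.symm Θ.target ∧
      ∀ y ∈ Θ.source, ∑ j, (Θ y j) ^ 2 = -MvPolynomial.eval (Fin.insertNth i (1 : ℂ) y : Fin (n + 2) → ℂ) F := by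
  obtain ⟨Θ₀, h0s, hΘ₀0, -, hΘ₀, hΘ₀s, hΘ₀F⟩ := hp.exists_holomorphicMorseChart hF hd (m := i) hpi
  set y₀ : Fin (n + 1) → ℂ := fun j => p (i.succAbove j) / p i with hy₀
  -- a square root `μ` of `−pᵢ^{−d}`
  obtain ⟨μ, hμ⟩ := IsAlgClosed.exists_pow_nat_eq (-((p i) ^ d)⁻¹) two_pos
  have hμ0 : μ ≠ 0 := by
    intro h
    rw [h, zero_pow two_ne_zero] at hμ
    exact (neg_ne_zero.mpr (inv_ne_zero (pow_ne_zero d hpi))) hμ.symm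
  -- the affine map `y ↦ pᵢ • (y − y₀)` and the scaling `z ↦ μ • z`
  let A : (Fin (n + 1) → ℂ) ≃ₜ (Fin (n + 1) → ℂ) :=
    (Homeomorph.addRight (-y₀)).trans (Homeomorph.smulOfNeZero (p i) hpi)
  let M : (Fin (n + 1) → ℂ) ≃ₜ (Fin (n + 1) → ℂ) := Homeomorph.smulOfNeZero μ hμ0
  have hA : ∀ y, A y = (p i) • (y - y₀) := fun y => by
    simp [A, sub_eq_add_neg]
  have hAs : ∀ w, A.symm w = (p i)⁻¹ • w + y₀ := fun w => by
    change (Homeomorph.addRight (-y₀)).symm ((Homeomorph.smulOfNeZero (p i) hpi).symm w) = _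
    rw [Homeomorph.smulOfNeZero_symm_apply, Homeomorph.addRight_symm, Homeomorph.coe_addRight, neg_neg]
  have hM : ∀ z, M z = μ • z := fun z => rfl
  have hMs : ∀ z, M.symm z = μ⁻¹ • z := fun z => by simp [M]
  let Θ : OpenPartialHomeomorph (Fin (n + 1) → ℂ) (Fin (n + 1) → ℂ) := (A.transOpenPartialHomeomorph Θ₀).transHomeomorph M
  have hΘapp : ∀ y, Θ y = μ • Θ₀ ((p i) • (y - y₀)) := fun y => by
    change M (Θ₀ (A y)) = _
    rw [hA]; rfl
  have hΘsrc : Θ.source = A ⁻¹' Θ₀.source := rfl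
  have hΘtgt : Θ.target = M.symm ⁻¹' Θ₀.target := rfl
  have hΘsymm : ∀ z, Θ.symm z = A.symm (Θ₀.symm (M.symm z)) := fun z => rfl
  have hAy₀ : A y₀ = 0 := by rw [hA, sub_self, smul_zero]
  refine ⟨Θ, ?_, ?_, ?_, ?_, ?_⟩
  · rw [hΘsrc, Set.mem_preimage, hAy₀]; exact h0s
  · rw [hΘapp, sub_self, smul_zero, hΘ₀0, smul_zero]
  · -- `Θ = M ∘ Θ₀ ∘ A` is `C^∞` on `A⁻¹' Θ₀.source`
    have hAc : ContDiff ℝ ∞ (fun y : Fin (n + 1) → ℂ => (p i) • (y - y₀)) :=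
      (contDiff_id.sub contDiff_const).const_smul _
    have h1 : ContDiffOn ℝ ∞ (fun y => Θ₀ ((p i) • (y - y₀))) (A ⁻¹' Θ₀.source) :=
      hΘ₀.comp hAc.contDiffOn fun y hy => by rw [Set.mem_preimage, hA] at hy; exact hy
    have h2 : ContDiffOn ℝ ∞ (fun y => μ • Θ₀ ((p i) • (y - y₀))) (A ⁻¹' Θ₀.source) := h1.const_smul μ
    rw [hΘsrc]
    exact h2.congr fun y _ => hΘapp y
  · -- `Θ.symm = A.symm ∘ Θ₀.symm ∘ M.symm`
    have hMc : ContDiff ℝ ∞ (fun z : Fin (n + 1) → ℂ => μ⁻¹ • z) := contDiff_id.const_smul _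
    have h1 : ContDiffOn ℝ ∞ (fun z => Θ₀.symm (μ⁻¹ • z)) (M.symm ⁻¹' Θ₀.target) :=
      hΘ₀s.comp hMc.contDiffOn fun z hz => by rw [Set.mem_preimage, hMs] at hz; exact hz
    have h2 : ContDiffOn ℝ ∞ (fun z => (p i)⁻¹ • Θ₀.symm (μ⁻¹ • z) + y₀) (M.symm ⁻¹' Θ₀.target) :=
      (h1.const_smul _).add contDiffOn_const
    rw [hΘtgt]
    exact h2.congr fun z _ => by rw [hΘsymm, hMs, hAs]
  · intro y hy
    rw [hΘsrc, Set.mem_preimage, hA] at hy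
    have hF0 := hΘ₀F _ hy
    -- `F(ins_i 1 y) = pᵢ^{−d} F(p + ins_i 0 (pᵢ (y − y₀)))`
    have heval : MvPolynomial.eval (Fin.insertNth i (1 : ℂ) y : Fin (n + 2) → ℂ) F =
        ((p i)⁻¹) ^ d * MvPolynomial.eval (p + Fin.insertNth i (0 : ℂ) ((p i) • (y - y₀))) F := by
      rw [insertNth_one_eq_smul i hpi y]
      exact Projectivization.eval_smul_of_isHomogeneous hF _ _
    rw [heval, hF0, hΘapp]
    simp only [Pi.smul_apply, smul_eq_mul, mul_pow, ← Finset.mul_sum, hμ, inv_pow]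
    ring

/-- **The Morse chart of the solved coefficient**, in the form consumed by the port (`NodalPencilShellFields`, `…SaturatedRadius`,
`…FoldIsotopy`): for `b₀ = coeffs F`, `regChartCoeffVec n d i (b'₀, y) (xᵢ^d) = (b₀)_{xᵢ^d} + Σⱼ (Θ y)ⱼ²` on `Θ.source`, and with
`φ(y) = regChartCoeffVec n d i (b'₀, y) (xᵢ^d) − (b₀)_{xᵢ^d}` also `Σⱼ (Θ y)ⱼ² = φ(y)`.
[cite: VoisinHodgeII2003, §2.1.1, §2.3.1 and §6.2.1] -/
theorem exists_pencil_morseChart_coeff {F : MvPolynomial (Fin (n + 2)) ℂ} (hF : F.IsHomogeneous d) (hd : 1 ≤ d)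
    {p : Fin (n + 2) → ℂ} (hp : IsOrdinaryDoublePointOf F p) {i : Fin (n + 2)} (hpi : p i ≠ 0) :
    ∃ Θ : OpenPartialHomeomorph (Fin (n + 1) → ℂ) (Fin (n + 1) → ℂ),
      (fun j => p (i.succAbove j) / p i) ∈ Θ.source ∧ Θ (fun j => p (i.succAbove j) / p i) = 0 ∧
      ContDiffOn ℝ ∞ Θ Θ.source ∧ ContDiffOn ℝ ∞ Θ.symm Θ.target ∧
      (∀ y ∈ Θ.source, regChartCoeffVec n d i
        (Sum.elim (fun m : {m : DegIndex n d // m ≠ regPowIndex n d i} => coeffsOf n d F m.1) y) (regPowIndex n d i) =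
          coeffsOf n d F (regPowIndex n d i) + ∑ j, (Θ y j) ^ 2) ∧
      ∀ y ∈ Θ.source, ∑ j, (Θ y j) ^ 2 = regChartCoeffVec n d i
        (Sum.elim (fun m : {m : DegIndex n d // m ≠ regPowIndex n d i} => coeffsOf n d F m.1) y) (regPowIndex n d i) -
          coeffsOf n d F (regPowIndex n d i) := by
  obtain ⟨Θ, hy₀, hΘ0, hΘ, hΘs, hΘF⟩ := exists_pencil_morseChart hF hd hp hpi
  have hc₀ : coeffsOf n d F (regPowIndex n d i) = MvPolynomial.coeff (Finsupp.single i d) F := rfl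
  refine ⟨Θ, hy₀, hΘ0, hΘ, hΘs, fun y hy => ?_, fun y hy => ?_⟩
  · rw [regChartCoeffVec_pencil_regPowIndex_of_isHomogeneous n d i hF, hΘF y hy, hc₀]
    ring
  · rw [regChartCoeffVec_pencil_regPowIndex_of_isHomogeneous n d i hF, hΘF y hy, hc₀]
    ring

end NodalPencil

end Literature.AlgebraicGeometry.HodgeTheory

end
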